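import Literature.AlgebraicGeometry.HodgeTheory.CMHodgeGroupNoTwistThree
import HarnessLib

/-!
# A twist between two mixed `𝔰𝔩₃`-blocks of `[𝔤,𝔤]` forces a rational Hodge endomorphism that does not separate the two
# places: the associative ENVELOPE of the derived algebra (Moonen–Zarhin 1999 §2 (2.3); Ribet 1983 §3)

Family `hodge`, layer `Literature/AlgebraicGeometry/HodgeTheory` (cell `pub-hodgeav-hg6`, req-37 (A) Q2b, TABLE X ROW 10 —
`End⁰ = E` a quartic CM field, `dim_E H¹ = 3`, pattern `(2,1)+(2,1)` / `(2,1)+(1,2)` — first half of the no-twist brick for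
two MIXED places). UNCONDITIONAL; theorems only, no definition, no named fact, no `sorry`. HONEST FRAMING of that cell:
HC / HC_AV / HC_CM / H2 NOT proved — linear algebra of polarized weight-one `ℚ`-Hodge structures.

SETTING as in `CMNoTwist3.*`: `n₀ = 3`, an admissible bracket-closed `𝔤 ∋ Θ`, the complex derived span `𝔇 = (𝔡)_ℂ`
preserving the blocks `W_k`, bases `bW k`, a MIXED place `i₀` at which `𝔇` induces every traceless endomorphism, and a
TWIST `(i₀, j)` in the sense of `LieGoursatTwist.lift_or_twist_of_submodules`: `[X|_{i₀}] = A⁻¹ [X|_j]^e A` (inner) or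
`[X|_{i₀}] = −A⁻¹ ([X|_j]^e)ᵀ A` (transpose) for all `X ∈ 𝔇`.
* `CMTwist.spanC_mul_mem` — the complex span of a rational subalgebra is closed under products.
* **`CMTwist.exists_mem_endAlg_of_twist`** — THE ENVELOPE: there is a RATIONAL Hodge endomorphism `t ∈ End_Hdg(V) = E`
  which is not a rational scalar and which, together with its Rosati adjoint `t†`, acts on `W_{μ i₀}` and `W_{μ j}` by
  scalars tied by the twist: inner ⟹ `τ_{i₀}(t) = τ_j(t)` and `τ_{i₀}(t†) = τ_j(t†)`; transpose ⟹ `τ_{i₀}(t) = τ_j(t†)` and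
  `τ_{i₀}(t†) = τ_j(t)`. PROOF (Galois-free, classification-free): let `𝒜 = ℚ⟨𝔡⟩` be the associative subalgebra of
  `End_ℚ(V)` generated by `𝔡` (`†`-stable, commuting with `E`); the twist relation propagates from `𝔡` to `𝒜` by
  multiplicativity (`[Z|_{i₀}] = A⁻¹[Z|_j]^e A`, resp. `[Z|_{i₀}] = A⁻¹([Z†|_j]^e)ᵀ A` — `†` is the anti-automorphism
  extending `X ↦ −X`). With `X ∈ 𝔇` inducing `Θ − c` on `W_{μ i₀}` (`c = t_{i₀}/3`, `t_{i₀} = dim W^{1,0} − dim W^{0,1} = ±1`,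
  so `(X|_{i₀} + c)² = 1`), the CUBIC `R = X³ − (3c² + 1)X ∈ 𝒜_ℂ` is `ψ_ℂ`-skew and acts on `W_{μ i₀}` by the scalar
  `κ = 2c(c² − 1) ≠ 0` and on `W_{μ j}` by `±κ` (transported matrix identity); hence `R` commutes with `𝔤_ℂ` (skew
  determination on the two blocks), so `R ∈ 𝒜_ℂ ∩ E_ℂ = (𝒜 ∩ E)_ℂ` (`ThetaSubalgebra.mem_span_endAlg_of_forall_commute`,
  `spanC_inf_eq`), and `𝒜 ∩ E` cannot consist of rational scalars (a skew non-zero `R` is not a scalar).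

## References
* [MoonenZarhin1999LowDim] B. Moonen, Yu. Zarhin, Math. Ann. 315 (1999), §2 (2.3).
* [Ribet1983] K. A. Ribet, Amer. J. Math. 105 (1983), §3 (Lie algebra lemma; the twist by a character of the centre).
* [Deligne1982HodgeCycles] P. Deligne, LNM 900 (1982), I §3 (proof of Prop. 3.4: rational structures), §4 (p. 30).
-/

noncomputable section

open scoped TensorProduct
open Module Matrix

namespace Literature.AlgebraicGeometry.Motives

namespace HodgeStructure

universe u

variable {V : Type u} [AddCommGroup V] [Module ℚ V] {n : ℤ}

/-! ### §1 Generalities: complex span of a rational algebra, rational scalars -/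

/-- **The complex span of a rational subalgebra of `End_ℚ(V)` is closed under products.**
[cite: Deligne1982HodgeCycles, I §3 (proof of Prop. 3.4)] -/
theorem CMTwist.spanC_mul_mem (𝒜 : Subalgebra ℚ (Module.End ℚ V)) {Y Y' : Module.End ℂ (ℂ ⊗[ℚ] V)}
    (hY : Y ∈ spanC (Subalgebra.toSubmodule 𝒜)) (hY' : Y' ∈ spanC (Subalgebra.toSubmodule 𝒜)) :
    Y * Y' ∈ spanC (Subalgebra.toSubmodule 𝒜) := by
  induction hY using Submodule.span_induction generalizing Y' with
  | mem Z hZ =>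
    obtain ⟨X, hX, rfl⟩ := hZ
    induction hY' using Submodule.span_induction with
    | mem Z' hZ' =>
      obtain ⟨X', hX', rfl⟩ := hZ'
      rw [← LinearMap.baseChange_mul]
      exact baseChange_mem_spanC (𝒜.mul_mem hX hX')
    | zero => rw [mul_zero]; exact Submodule.zero_mem _
    | add Z₁ Z₂ _ _ h₁ h₂ => rw [mul_add]; exact Submodule.add_mem _ h₁ h₂
    | smul c Z₁ _ h₁ => rw [mul_smul_comm]; exact Submodule.smul_mem _ c h₁
  | zero => rw [zero_mul]; exact Submodule.zero_mem _
  | add Z₁ Z₂ _ _ h₁ h₂ => rw [add_mul]; exact Submodule.add_mem _ (h₁ hY') (h₂ hY')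
  | smul c Z₁ _ h₁ => rw [smul_mul_assoc]; exact Submodule.smul_mem _ c (h₁ hY')

/-- Base change of a rational multiple: `(q • X)_ℂ = q • X_ℂ` with `q` read in `ℂ`. [folklore] -/
private theorem CMTwist.baseChange_rat_smul (q : ℚ) (X : Module.End ℚ V) :
    (q • X).baseChange ℂ = (q : ℂ) • X.baseChange ℂ := by
  rw [LinearMap.baseChange_smul]
  exact LinearMap.ext fun w => by
    rw [LinearMap.smul_apply, LinearMap.smul_apply, ← algebraMap_smul ℂ q (X.baseChange ℂ w), eq_ratCast]

/-- **The cubic identity**: for a matrix `T` with `T² = 1` and `M = T − c`, `M³ − (3c² + 1) M = 2c(c² − 1)`.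
[cite: MoonenZarhin1999LowDim, §2 (2.3)] -/
theorem CMTwist.cube_sub_smul_eq {d : ℕ} (T : Matrix (Fin d) (Fin d) ℂ) (hT : T * T = 1) (c : ℂ) :
    (T + (-c) • (1 : Matrix (Fin d) (Fin d) ℂ)) * (T + (-c) • 1) * (T + (-c) • 1) +
        (-(3 * c ^ 2 + 1)) • (T + (-c) • 1) =
      (2 * c * (c ^ 2 - 1)) • (1 : Matrix (Fin d) (Fin d) ℂ) := by
  have h2 : (T + (-c) • (1 : Matrix (Fin d) (Fin d) ℂ)) * (T + (-c) • 1) =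
      (1 + c ^ 2) • (1 : Matrix (Fin d) (Fin d) ℂ) + (-(2 * c)) • T := by
    simp only [add_mul, mul_add, smul_mul_assoc, mul_smul_comm, one_mul, mul_one, hT]
    module
  rw [h2]
  simp only [add_mul, mul_add, smul_mul_assoc, mul_smul_comm, one_mul, mul_one, smul_smul, hT, smul_add]
  module

/-- Applied `submatrix` of a scalar multiple. [folklore] -/
private theorem CMTwist.submatrix_smul_apply {l m : Type*} (r : ℂ) (A : Matrix m m ℂ) (e f : l → m) :
    (r • A).submatrix e f = r • A.submatrix e f := rfl

/-- Applied `submatrix` of a sum. [folklore] -/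
private theorem CMTwist.submatrix_add_apply {l m : Type*} (A B : Matrix m m ℂ) (e f : l → m) :
    (A + B).submatrix e f = A.submatrix e f + B.submatrix e f := rfl

/-- Applied `submatrix` of a negative. [folklore] -/
private theorem CMTwist.submatrix_neg_apply {l m : Type*} (A : Matrix m m ℂ) (e f : l → m) :
    (-A).submatrix e f = -A.submatrix e f := rfl

section Hodge

variable [Module.Finite ℚ V] [HodgeTensorFacts.{u, u}]

/-! ### §2 The envelope of a twist -/

set_option maxHeartbeats 400000 in
/-- **THE ENVELOPE OF A TWIST** (see the module docstring): a twist between the blocks `W_{μ i₀}` (mixed) and `W_{μ j}` of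
the complex derived span of an admissible `𝔤 ∋ Θ` (`n₀ = 3`, `|ι| ≤ 2`) yields a rational `t ∈ End_Hdg(V)`, not a rational
scalar, whose scalars on `W_{μ i₀}`, `W_{μ j}` and those of `t†` are tied by the twist. [cite: MoonenZarhin1999LowDim, §2 (2.3)]
[cite: Ribet1983, §3] [cite: Deligne1982HodgeCycles, I §3 (proof of Prop. 3.4)] -/
theorem CMTwist.exists_mem_endAlg_of_twist {ι : Type} [Fintype ι] [DecidableEq ι] (hι : Fintype.card ι ≤ 2)
    (H : HodgeStructure V n) (hn : n = 1) (heff : H.IsEffective) (ψ : H.Polarization)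
    {φ : Module.End ℚ V} (hφE : φ ∈ H.endAlg) {m : ℕ} (hE : ∀ a ∈ H.endAlg, ∃ q : Fin m → ℚ, a = ∑ k, q k • φ ^ (k : ℕ))
    (μ : ι → ℂ) (hinj : Function.Injective μ) (hdist : ∀ k k', μ k' ≠ starRingEnd ℂ (μ k))
    (hrank : ∀ k, Module.finrank ℂ ↥(Module.End.eigenspace (φ.baseChange ℂ) (μ k) ⊓ H.piece 1 0) +
      Module.finrank ℂ ↥(Module.End.eigenspace (φ.baseChange ℂ) (μ k) ⊓ H.piece 0 1) = 3)
    (htop : (⨆ kt : ι × Fin 2, Module.End.eigenspace (φ.baseChange ℂ)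
      (if kt.2 = 0 then μ kt.1 else starRingEnd ℂ (μ kt.1))) = ⊤)
    (𝔤 : Submodule ℚ (Module.End ℚ V)) (hbr : ∀ X ∈ 𝔤, ∀ X' ∈ 𝔤, X * X' - X' * X ∈ 𝔤)
    (hcomm : ∀ X ∈ 𝔤, ∀ a : H.endAlg, X * (a : Module.End ℚ V) = (a : Module.End ℚ V) * X)
    (hskew : ∀ X ∈ 𝔤, ∀ v w, ψ.form (X v) w + ψ.form v (X w) = 0)
    {Θ : Module.End ℂ (ℂ ⊗[ℚ] V)} (hΘ : ∀ p, ∀ x ∈ H.piece p (n - p), Θ x = ((2 * p - n : ℤ) : ℂ) • x)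
    (hΘ𝔤 : Θ ∈ spanC 𝔤)
    (hW : ∀ X ∈ spanC (Submodule.span ℚ {B | ∃ X ∈ 𝔤, ∃ X' ∈ 𝔤, X * X' - X' * X = B}), ∀ i,
      ∀ w ∈ Module.End.eigenspace (φ.baseChange ℂ) (μ i), X w ∈ Module.End.eigenspace (φ.baseChange ℂ) (μ i))
    (bW : ∀ i, Module.Basis (Fin 3) ℂ ↥(Module.End.eigenspace (φ.baseChange ℂ) (μ i)))
    (i₀ : ι) (hmix : Module.finrank ℂ ↥(Module.End.eigenspace (φ.baseChange ℂ) (μ i₀) ⊓ H.piece 1 0) ≠ 0 ∧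
      Module.finrank ℂ ↥(Module.End.eigenspace (φ.baseChange ℂ) (μ i₀) ⊓ H.piece 0 1) ≠ 0)
    (hproj : ∀ Z : Module.End ℂ ↥(Module.End.eigenspace (φ.baseChange ℂ) (μ i₀)), LinearMap.trace ℂ _ Z = 0 →
      ∃ X ∈ spanC (Submodule.span ℚ {B | ∃ X ∈ 𝔤, ∃ X' ∈ 𝔤, X * X' - X' * X = B}),
        ∀ w : ↥(Module.End.eigenspace (φ.baseChange ℂ) (μ i₀)), X w = Z w)
    (j : ι) (hj : j ≠ i₀) (e : Fin 3 ≃ Fin 3) (A : Matrix (Fin 3) (Fin 3) ℂ) (hA : IsUnit A)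
    (htw : (∀ X (hX : X ∈ spanC (Submodule.span ℚ {B | ∃ X ∈ 𝔤, ∃ X' ∈ 𝔤, X * X' - X' * X = B})),
        LinearMap.toMatrix (bW i₀) (bW i₀) (X.restrict (hW X hX i₀)) =
          A⁻¹ * (LinearMap.toMatrix (bW j) (bW j) (X.restrict (hW X hX j))).submatrix e.symm e.symm * A) ∨
      (2 < 3 ∧ ∀ X (hX : X ∈ spanC (Submodule.span ℚ {B | ∃ X ∈ 𝔤, ∃ X' ∈ 𝔤, X * X' - X' * X = B})),
        LinearMap.toMatrix (bW i₀) (bW i₀) (X.restrict (hW X hX i₀)) =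
          -(A⁻¹ * ((LinearMap.toMatrix (bW j) (bW j) (X.restrict (hW X hX j))).submatrix e.symm e.symm)ᵀ * A))) :
    ∃ t ∈ H.endAlg, (∀ q : ℚ, t ≠ q • 1) ∧ ∃ α β : ℂ,
      (∀ w ∈ Module.End.eigenspace (φ.baseChange ℂ) (μ i₀), t.baseChange ℂ w = α • w) ∧
      (∀ w ∈ Module.End.eigenspace (φ.baseChange ℂ) (μ i₀), (ψ.adjoint t).baseChange ℂ w = β • w) ∧
      (((∀ w ∈ Module.End.eigenspace (φ.baseChange ℂ) (μ j), t.baseChange ℂ w = α • w) ∧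
          (∀ w ∈ Module.End.eigenspace (φ.baseChange ℂ) (μ j), (ψ.adjoint t).baseChange ℂ w = β • w)) ∨
        ((∀ w ∈ Module.End.eigenspace (φ.baseChange ℂ) (μ j), (ψ.adjoint t).baseChange ℂ w = α • w) ∧
          (∀ w ∈ Module.End.eigenspace (φ.baseChange ℂ) (μ j), t.baseChange ℂ w = β • w))) := by
  classical
  -- notation and basic facts
  let W : ι → Submodule ℂ (ℂ ⊗[ℚ] V) := fun i => Module.End.eigenspace (φ.baseChange ℂ) (μ i)
  have hWdef : ∀ i, W i = Module.End.eigenspace (φ.baseChange ℂ) (μ i) := fun i => rfl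
  let 𝔡 : Submodule ℚ (Module.End ℚ V) := Submodule.span ℚ {B | ∃ X ∈ 𝔤, ∃ X' ∈ 𝔤, X * X' - X' * X = B}
  have h𝔡def : 𝔡 = Submodule.span ℚ {B | ∃ X ∈ 𝔤, ∃ X' ∈ 𝔤, X * X' - X' * X = B} := rfl
  have h𝔡𝔤 : 𝔡 ≤ 𝔤 := CMDerived.derived_le hbr
  have h𝔇𝔊 : spanC 𝔡 ≤ spanC 𝔤 := spanC_mono h𝔡𝔤
  have hEcomm : ∀ a ∈ H.endAlg, ∀ a' ∈ H.endAlg, a * a' = a' * a := fun a ha a' ha' =>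
    CMThetaCentre.mul_comm_of_hE H hE ha ha'
  have hdet : IsUnit A.det := (Matrix.isUnit_iff_isUnit_det A).1 hA
  have hAA : A⁻¹ * A = 1 := Matrix.nonsing_inv_mul A hdet
  have hAA' : A * A⁻¹ = 1 := Matrix.mul_nonsing_inv A hdet
  have hfin : ∀ i, Module.finrank ℂ ↥(W i) = 3 := fun i => by
    rw [hWdef, CMTheta.finrank_eigenspace_eq_add H hn heff hφE, hrank i]
  -- every place is `i₀` or `j`
  have huniv : ∀ i, i = i₀ ∨ i = j := by
    intro i
    by_contra hne
    rw [not_or] at hne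
    have h3 : ({i, i₀, j} : Finset ι).card = 3 := by
      rw [Finset.card_insert_of_notMem (by simp [hne.1, hne.2]), Finset.card_insert_of_notMem (by simp [hj.symm]),
        Finset.card_singleton]
    have hle : ({i, i₀, j} : Finset ι).card ≤ Fintype.card ι := Finset.card_le_univ _
    omega
  /- §A the envelope `𝒜 = ℚ⟨𝔡⟩` -/
  let 𝒜 : Subalgebra ℚ (Module.End ℚ V) := Algebra.adjoin ℚ (𝔡 : Set (Module.End ℚ V))
  have h𝔡𝒜 : ∀ X ∈ 𝔡, X ∈ 𝒜 := fun X hX => Algebra.subset_adjoin hX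
  have h𝒜comm : ∀ Z ∈ 𝒜, ∀ a : H.endAlg, Z * (a : Module.End ℚ V) = (a : Module.End ℚ V) * Z := by
    intro Z hZ a
    induction hZ using Algebra.adjoin_induction with
    | mem X hX => exact hcomm X (h𝔡𝔤 hX) a
    | algebraMap r => rw [Algebra.algebraMap_eq_smul_one, smul_mul_assoc, one_mul, mul_smul_comm, mul_one]
    | add Z Z' _ _ h h' => rw [add_mul, mul_add, h, h']
    | mul Z Z' _ _ h h' => rw [mul_assoc, h', ← mul_assoc, h, mul_assoc]
  have hadjX : ∀ X ∈ 𝔡, ψ.adjoint X = -X := fun X hX =>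
    (ψ.eq_adjoint_of_isAdjointPair (a := X) (b := -X) fun v w => by
      rw [LinearMap.neg_apply, map_neg, eq_neg_iff_add_eq_zero]; exact hskew X (h𝔡𝔤 hX) v w).symm
  have h𝒜adj : ∀ Z ∈ 𝒜, ψ.adjoint Z ∈ 𝒜 := by
    intro Z hZ
    induction hZ using Algebra.adjoin_induction with
    | mem X hX => rw [hadjX X hX]; exact 𝒜.neg_mem (h𝔡𝒜 X hX)
    | algebraMap r => rw [Algebra.algebraMap_eq_smul_one, ψ.adjoint_smul, ψ.adjoint_one]; exact 𝒜.smul_mem 𝒜.one_mem r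
    | add Z Z' _ _ h h' => rw [ψ.adjoint_add]; exact 𝒜.add_mem h h'
    | mul Z Z' _ _ h h' => rw [ψ.adjoint_mul]; exact 𝒜.mul_mem h' h
  have h𝒜φ : ∀ Z ∈ 𝒜, Z.baseChange ℂ * φ.baseChange ℂ = φ.baseChange ℂ * Z.baseChange ℂ := fun Z hZ => by
    rw [← LinearMap.baseChange_mul, h𝒜comm Z hZ ⟨φ, hφE⟩, LinearMap.baseChange_mul]
  have h𝒜W : ∀ Z ∈ 𝒜, ∀ i, ∀ w ∈ W i, Z.baseChange ℂ w ∈ W i := fun Z hZ i w hw =>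
    UnitaryTheta.apply_mem_eigenspace_of_commute (h𝒜φ Z hZ) hw
  -- the matrices `M i Z = [Z_ℂ|_{W i}]`
  let M : ∀ (i : ι) (Z : Module.End ℚ V), Z ∈ 𝒜 → Matrix (Fin 3) (Fin 3) ℂ := fun i Z hZ =>
    LinearMap.toMatrix (bW i) (bW i) ((Z.baseChange ℂ).restrict (h𝒜W Z hZ i))
  have hMdef : ∀ i Z (hZ : Z ∈ 𝒜), M i Z hZ = LinearMap.toMatrix (bW i) (bW i) ((Z.baseChange ℂ).restrict (h𝒜W Z hZ i)) :=
    fun _ _ _ => rfl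
  have hMcongr : ∀ i Z Z' (hZ : Z ∈ 𝒜) (hZ' : Z' ∈ 𝒜), Z = Z' → M i Z hZ = M i Z' hZ' := by
    intro i Z Z' hZ hZ' h; subst h; rfl
  have hMmul : ∀ i Z Z' (hZ : Z ∈ 𝒜) (hZ' : Z' ∈ 𝒜), M i (Z * Z') (𝒜.mul_mem hZ hZ') = M i Z hZ * M i Z' hZ' := by
    intro i Z Z' hZ hZ'
    simp only [hMdef]
    rw [← LinearMap.toMatrix_mul]
    congr 1
    exact LinearMap.ext fun w => Subtype.ext (by
      simp only [LinearMap.coe_restrict_apply, Module.End.mul_apply, LinearMap.baseChange_mul])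
  have hMadd : ∀ i Z Z' (hZ : Z ∈ 𝒜) (hZ' : Z' ∈ 𝒜), M i (Z + Z') (𝒜.add_mem hZ hZ') = M i Z hZ + M i Z' hZ' := by
    intro i Z Z' hZ hZ'
    simp only [hMdef]
    rw [← map_add]
    congr 1
    exact LinearMap.ext fun w => Subtype.ext (by
      simp only [LinearMap.coe_restrict_apply, LinearMap.add_apply, Submodule.coe_add, LinearMap.baseChange_add])
  have hMsmul : ∀ i (q : ℚ) Z (hZ : Z ∈ 𝒜), M i (q • Z) (𝒜.smul_mem hZ q) = (q : ℂ) • M i Z hZ := by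
    intro i q Z hZ
    simp only [hMdef]
    rw [← map_smul]
    congr 1
    exact LinearMap.ext fun w => Subtype.ext (by
      simp only [LinearMap.coe_restrict_apply, LinearMap.smul_apply, Submodule.coe_smul, CMTwist.baseChange_rat_smul])
  have hMone : ∀ i, M i 1 𝒜.one_mem = 1 := by
    intro i
    simp only [hMdef]
    rw [← LinearMap.toMatrix_one (bW i)]
    congr 1
    exact LinearMap.ext fun w => Subtype.ext (by
      simp only [LinearMap.coe_restrict_apply, LinearMap.baseChange_one, Module.End.one_apply])
  have hMalg : ∀ i (r : ℚ), M i (algebraMap ℚ (Module.End ℚ V) r) (𝒜.algebraMap_mem r) = (r : ℂ) • 1 := by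
    intro i r
    rw [hMcongr i _ _ (𝒜.algebraMap_mem r) (𝒜.smul_mem 𝒜.one_mem r) (Algebra.algebraMap_eq_smul_one r),
      hMsmul i r 1 𝒜.one_mem, hMone]
  have hMneg : ∀ i Z (hZ : Z ∈ 𝒜), M i (-Z) (𝒜.neg_mem hZ) = -M i Z hZ := by
    intro i Z hZ
    rw [hMcongr i _ _ (𝒜.neg_mem hZ) (𝒜.smul_mem hZ (-1 : ℚ)) (neg_one_smul ℚ Z).symm, hMsmul i (-1) Z hZ]
    simp
  -- for `X ∈ 𝔡` the matrix is the one of the twist datum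
  have hMgen : ∀ i X (hX : X ∈ 𝔡), M i X (h𝔡𝒜 X hX) =
      LinearMap.toMatrix (bW i) (bW i) ((X.baseChange ℂ).restrict (hW _ (baseChange_mem_spanC hX) i)) := fun _ _ _ => rfl
  -- an element of `E` acts on `W i` by a scalar; its matrix is scalar
  have hMscal : ∀ i (t : Module.End ℚ V) (ht : t ∈ 𝒜) (s : ℂ), (∀ w ∈ W i, t.baseChange ℂ w = s • w) →
      M i t ht = s • 1 := by
    intro i t ht s hs
    simp only [hMdef]
    rw [← LinearMap.toMatrix_one (bW i), ← map_smul]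
    congr 1
    exact LinearMap.ext fun w => Subtype.ext (by
      rw [LinearMap.coe_restrict_apply, hs w w.2, LinearMap.smul_apply, Module.End.one_apply, Submodule.coe_smul])
  have hscal_of_M : ∀ i (t : Module.End ℚ V) (ht : t ∈ 𝒜) (s : ℂ), M i t ht = s • 1 →
      ∀ w ∈ W i, t.baseChange ℂ w = s • w := by
    intro i t ht s hM w hw
    have h1 : (t.baseChange ℂ).restrict (h𝒜W t ht i) = s • 1 := by
      apply (LinearMap.toMatrix (bW i) (bW i)).injective
      rw [map_smul, LinearMap.toMatrix_one (bW i)]; exact hM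
    have h2 := congrArg (fun T : Module.End ℂ ↥(W i) => ((T ⟨w, hw⟩ : ↥(W i)) : ℂ ⊗[ℚ] V)) h1
    simpa only [LinearMap.coe_restrict_apply, LinearMap.smul_apply, Module.End.one_apply, Submodule.coe_smul] using h2
  /- §B the cubic `R = X³ − (3c²+1) X` -/
  obtain ⟨-, -, hΘ10, hΘ01, hΘΘ⟩ := UnitaryTheta.theta_facts H hn heff hΘ
  have hΘφ : Θ * φ.baseChange ℂ = φ.baseChange ℂ * Θ := UnitaryTheta.commute_of_mem_spanC H hφE hcomm hΘ𝔤
  have hΘW : ∀ i, ∀ w ∈ W i, Θ w ∈ W i := fun i w hw => UnitaryTheta.apply_mem_eigenspace_of_commute hΘφ hw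
  set c : ℂ := (((Module.finrank ℂ ↥(Module.End.eigenspace (φ.baseChange ℂ) (μ i₀) ⊓ H.piece 1 0) : ℂ) -
    (Module.finrank ℂ ↥(Module.End.eigenspace (φ.baseChange ℂ) (μ i₀) ⊓ H.piece 0 1) : ℂ))) / 3 with hcdef
  have hκ : 2 * c * (c ^ 2 - 1) ≠ 0 := by
    have h3 := hrank i₀
    have hc' : c = 1 / 3 ∨ c = -1 / 3 := by
      have hcase : (Module.finrank ℂ ↥(Module.End.eigenspace (φ.baseChange ℂ) (μ i₀) ⊓ H.piece 1 0) = 2 ∧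
            Module.finrank ℂ ↥(Module.End.eigenspace (φ.baseChange ℂ) (μ i₀) ⊓ H.piece 0 1) = 1) ∨
          (Module.finrank ℂ ↥(Module.End.eigenspace (φ.baseChange ℂ) (μ i₀) ⊓ H.piece 1 0) = 1 ∧
            Module.finrank ℂ ↥(Module.End.eigenspace (φ.baseChange ℂ) (μ i₀) ⊓ H.piece 0 1) = 2) := by
        have ha := hmix.1; have hb := hmix.2; omega
      rcases hcase with ⟨ha, hb⟩ | ⟨ha, hb⟩
      · left; rw [hcdef, ha, hb]; norm_num
      · right; rw [hcdef, ha, hb]; norm_num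
    rcases hc' with h | h <;> rw [h] <;> norm_num
  -- `X ∈ 𝔇` inducing `Θ − c` on `W i₀`
  let Z₀ : Module.End ℂ ↥(W i₀) := Θ.restrict (hΘW i₀) + (-c) • 1
  have hZ₀ : LinearMap.trace ℂ _ Z₀ = 0 := by
    simp only [Z₀]
    rw [map_add, map_smul, LinearMap.trace_one, hfin i₀, CMArith.trace_restrict_theta H hn heff hΘ (hΘW i₀), hcdef]
    simp only [smul_eq_mul]
    push_cast
    ring
  obtain ⟨X, hX𝔇, hXZ⟩ := hproj Z₀ hZ₀
  have hXi : ∀ w ∈ W i₀, X w = Θ w + (-c) • w := fun w hw => by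
    have h := hXZ ⟨w, hw⟩
    simpa only [Z₀, LinearMap.add_apply, LinearMap.smul_apply, Module.End.one_apply, Submodule.coe_add,
      Submodule.coe_smul, LinearMap.coe_restrict_apply] using h
  -- matrices on `W i₀`: `MX = T − c`, `T² = 1`
  set T : Matrix (Fin 3) (Fin 3) ℂ := LinearMap.toMatrix (bW i₀) (bW i₀) (Θ.restrict (hΘW i₀)) with hTdef
  set MX : Matrix (Fin 3) (Fin 3) ℂ := LinearMap.toMatrix (bW i₀) (bW i₀) (X.restrict (hW X hX𝔇 i₀)) with hMXdef
  have hTT : T * T = 1 := by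
    rw [hTdef, ← LinearMap.toMatrix_mul, ← LinearMap.toMatrix_one (bW i₀)]
    congr 1
    exact LinearMap.ext fun w => Subtype.ext (by
      simp only [Module.End.mul_apply, LinearMap.coe_restrict_apply, Module.End.one_apply, hΘΘ])
  have hMX : MX = T + (-c) • 1 := by
    rw [hMXdef, hTdef, ← LinearMap.toMatrix_one (bW i₀), ← map_smul, ← map_add]
    congr 1
    exact LinearMap.ext fun w => Subtype.ext (by
      simp only [LinearMap.coe_restrict_apply, LinearMap.add_apply, LinearMap.smul_apply, Module.End.one_apply,
        Submodule.coe_add, Submodule.coe_smul, hXi w w.2])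
  have hcubic : MX * MX * MX + (-(3 * c ^ 2 + 1)) • MX = (2 * c * (c ^ 2 - 1)) • 1 := by
    rw [hMX]; exact CMTwist.cube_sub_smul_eq T hTT c
  -- the operator `R` and its restrictions
  obtain ⟨R, hRdef⟩ : ∃ R : Module.End ℂ (ℂ ⊗[ℚ] V), R = X * X * X + (-(3 * c ^ 2 + 1)) • X := ⟨_, rfl⟩
  have hXW : ∀ i, ∀ w ∈ W i, X w ∈ W i := fun i => hW X hX𝔇 i
  have hRW : ∀ i, ∀ w ∈ W i, R w ∈ W i := fun i w hw => by
    rw [hRdef, LinearMap.add_apply, LinearMap.smul_apply, Module.End.mul_apply, Module.End.mul_apply]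
    exact Submodule.add_mem _ (hXW i _ (hXW i _ (hXW i w hw))) (Submodule.smul_mem _ _ (hXW i w hw))
  have hRmat : ∀ i, LinearMap.toMatrix (bW i) (bW i) (R.restrict (hRW i)) =
      LinearMap.toMatrix (bW i) (bW i) (X.restrict (hXW i)) * LinearMap.toMatrix (bW i) (bW i) (X.restrict (hXW i)) *
        LinearMap.toMatrix (bW i) (bW i) (X.restrict (hXW i)) +
      (-(3 * c ^ 2 + 1)) • LinearMap.toMatrix (bW i) (bW i) (X.restrict (hXW i)) := by
    intro i
    rw [← LinearMap.toMatrix_mul, ← LinearMap.toMatrix_mul, ← map_smul, ← map_add]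
    congr 1
    exact LinearMap.ext fun w => Subtype.ext (by
      simp only [LinearMap.coe_restrict_apply, hRdef, LinearMap.add_apply, LinearMap.smul_apply, Module.End.mul_apply,
        Submodule.coe_add, Submodule.coe_smul])
  -- `R = κ` on `W i₀`
  have hRi : LinearMap.toMatrix (bW i₀) (bW i₀) (R.restrict (hRW i₀)) = (2 * c * (c ^ 2 - 1)) • 1 := by
    rw [hRmat i₀]; exact hcubic
  -- `R = ± κ` on `W j` (transported through the twist)
  have hconj : A * (MX * MX * MX + (-(3 * c ^ 2 + 1)) • MX) * A⁻¹ = (2 * c * (c ^ 2 - 1)) • 1 := by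
    rw [hcubic, Matrix.mul_smul, Matrix.mul_one, Matrix.smul_mul, hAA']
  have hRj : LinearMap.toMatrix (bW j) (bW j) (R.restrict (hRW j)) = (2 * c * (c ^ 2 - 1)) • 1 ∨
      LinearMap.toMatrix (bW j) (bW j) (R.restrict (hRW j)) = -((2 * c * (c ^ 2 - 1)) • 1) := by
    set N : Matrix (Fin 3) (Fin 3) ℂ := LinearMap.toMatrix (bW j) (bW j) (X.restrict (hXW j)) with hNdef
    have hRjN : LinearMap.toMatrix (bW j) (bW j) (R.restrict (hRW j)) = N * N * N + (-(3 * c ^ 2 + 1)) • N := hRmat j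
    rcases htw with htw | ⟨-, htw⟩
    · left
      -- `N^e = A MX A⁻¹`
      have h1 : N.submatrix e.symm e.symm = A * MX * A⁻¹ := by
        have h : MX = A⁻¹ * N.submatrix e.symm e.symm * A := htw X hX𝔇
        rw [h]
        simp only [Matrix.mul_assoc, hAA', Matrix.mul_one]
        rw [← Matrix.mul_assoc, hAA', Matrix.one_mul]
      have h2 : (N * N * N + (-(3 * c ^ 2 + 1)) • N).submatrix e.symm e.symm = (2 * c * (c ^ 2 - 1)) • 1 := by
        rw [CMTwist.submatrix_add_apply, CMTwist.submatrix_smul_apply,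
          ← Matrix.submatrix_mul_equiv (N * N) N e.symm e.symm e.symm, ← Matrix.submatrix_mul_equiv N N e.symm e.symm e.symm,
          h1, ← hconj]
        simp only [Matrix.mul_add, Matrix.add_mul, Matrix.mul_smul, Matrix.smul_mul, Matrix.mul_assoc]
        rw [← Matrix.mul_assoc A⁻¹ A, hAA, Matrix.one_mul, ← Matrix.mul_assoc A⁻¹ A, hAA, Matrix.one_mul]
      rw [hRjN]
      have h4 := congrArg (fun P : Matrix (Fin 3) (Fin 3) ℂ => P.submatrix e e) h2
      simp only [Matrix.submatrix_submatrix, Equiv.symm_comp_self, Matrix.submatrix_id_id, CMTwist.submatrix_smul_apply,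
        Matrix.submatrix_one_equiv] at h4
      exact h4
    · right
      -- `(N^e)ᵀ = −A MX A⁻¹`
      have h1 : (N.submatrix e.symm e.symm)ᵀ = -(A * MX * A⁻¹) := by
        have h : MX = -(A⁻¹ * (N.submatrix e.symm e.symm)ᵀ * A) := htw X hX𝔇
        rw [h]
        simp only [Matrix.mul_neg, Matrix.neg_mul, neg_neg, Matrix.mul_assoc, hAA', Matrix.mul_one]
        rw [← Matrix.mul_assoc, hAA', Matrix.one_mul]
      have h2 : ((N * N * N + (-(3 * c ^ 2 + 1)) • N).submatrix e.symm e.symm)ᵀ = -((2 * c * (c ^ 2 - 1)) • 1) := by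
        rw [CMTwist.submatrix_add_apply, CMTwist.submatrix_smul_apply,
          ← Matrix.submatrix_mul_equiv (N * N) N e.symm e.symm e.symm, ← Matrix.submatrix_mul_equiv N N e.symm e.symm e.symm,
          Matrix.transpose_add, Matrix.transpose_smul, Matrix.transpose_mul, Matrix.transpose_mul, h1, ← hconj]
        simp only [Matrix.mul_add, Matrix.add_mul, Matrix.mul_smul, Matrix.smul_mul, Matrix.mul_assoc, Matrix.mul_neg,
          Matrix.neg_mul, neg_neg, smul_neg, neg_add]
        rw [← Matrix.mul_assoc A⁻¹ A, hAA, Matrix.one_mul, ← Matrix.mul_assoc A⁻¹ A, hAA, Matrix.one_mul]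
      rw [hRjN]
      have h4 := congrArg (fun P : Matrix (Fin 3) (Fin 3) ℂ => (Pᵀ).submatrix e e) h2
      simp only [Matrix.transpose_transpose, Matrix.submatrix_submatrix, Equiv.symm_comp_self, Matrix.submatrix_id_id,
        Matrix.transpose_neg, Matrix.transpose_smul, Matrix.transpose_one, CMTwist.submatrix_neg_apply,
        CMTwist.submatrix_smul_apply, Matrix.submatrix_one_equiv] at h4
      exact h4
  -- from matrices to the action: `R w = κ w` on `W i₀`, `R w = ± κ w` on `W j`
  have hact : ∀ i (s : ℂ), LinearMap.toMatrix (bW i) (bW i) (R.restrict (hRW i)) = s • 1 → ∀ w ∈ W i, R w = s • w := by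
    intro i s hM w hw
    have h1 : R.restrict (hRW i) = s • 1 := by
      apply (LinearMap.toMatrix (bW i) (bW i)).injective
      rw [map_smul, LinearMap.toMatrix_one (bW i)]; exact hM
    have h2 := congrArg (fun T : Module.End ℂ ↥(W i) => ((T ⟨w, hw⟩ : ↥(W i)) : ℂ ⊗[ℚ] V)) h1
    simpa only [LinearMap.coe_restrict_apply, LinearMap.smul_apply, Module.End.one_apply, Submodule.coe_smul] using h2
  set κ : ℂ := 2 * c * (c ^ 2 - 1) with hκdef
  have hRi' : ∀ w ∈ W i₀, R w = κ • w := hact i₀ κ hRi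
  obtain ⟨κj, hκj, hRj'⟩ : ∃ κj : ℂ, (κj = κ ∨ κj = -κ) ∧ ∀ w ∈ W j, R w = κj • w := by
    rcases hRj with h | h
    · exact ⟨κ, Or.inl rfl, hact j κ h⟩
    · exact ⟨-κ, Or.inr rfl, hact j (-κ) (by rw [h, neg_smul])⟩
  have hRall : ∀ i, ∃ s : ℂ, ∀ w ∈ W i, R w = s • w := fun i => by
    rcases huniv i with rfl | rfl
    · exact ⟨κ, hRi'⟩
    · exact ⟨κj, hRj'⟩
  /- §C `R` is skew, commutes with `φ_ℂ`, hence commutes with `𝔤_ℂ` and lies in `E_ℂ` -/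
  have hXφ : X * φ.baseChange ℂ = φ.baseChange ℂ * X := UnitaryTheta.commute_of_mem_spanC H hφE hcomm (h𝔇𝔊 hX𝔇)
  have hXskew := ThetaSubalgebra.formBaseChange_add_eq_zero_of_mem_spanC ψ hskew (h𝔇𝔊 hX𝔇)
  have hXc : Commute X (φ.baseChange ℂ) := hXφ
  have hRφ : R * φ.baseChange ℂ = φ.baseChange ℂ * R := by
    rw [hRdef]
    exact (((hXc.mul_left hXc).mul_left hXc).add_left ((hXc).smul_left _)).eq
  have hRskew : ∀ x z, ψ.form.baseChange ℂ (R x) z + ψ.form.baseChange ℂ x (R z) = 0 := by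
    intro x z
    have a1 := hXskew (X (X x)) z
    have a2 := hXskew (X x) (X z)
    have a3 := hXskew x (X (X z))
    have a0 := hXskew x z
    rw [hRdef]
    simp only [LinearMap.add_apply, LinearMap.smul_apply, Module.End.mul_apply, map_add, map_smul, smul_eq_mul]
    linear_combination a1 - a2 + a3 + (-(3 * c ^ 2 + 1)) * a0
  have hRY : ∀ Y ∈ 𝔤, R * Y.baseChange ℂ = Y.baseChange ℂ * R := by
    intro Y hY
    have hYφ : Y.baseChange ℂ * φ.baseChange ℂ = φ.baseChange ℂ * Y.baseChange ℂ :=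
      UnitaryTheta.baseChange_commute H hφE hcomm hY
    have hYskewC := ThetaSubalgebra.formBaseChange_add_eq_zero_of_skew ψ (hskew Y hY)
    have hYW : ∀ i, ∀ w ∈ W i, Y.baseChange ℂ w ∈ W i := fun i w hw => UnitaryTheta.apply_mem_eigenspace_of_commute hYφ hw
    have hYc : Commute (Y.baseChange ℂ) (φ.baseChange ℂ) := hYφ
    have hRc : Commute R (φ.baseChange ℂ) := hRφ
    rw [← sub_eq_zero]
    refine CMThetaSocket.eq_zero_of_forall_eigenspace H hn heff ψ hφE hE μ hinj hdist htop ?_ ?_ ?_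
    · exact ((hRc.mul_left hYc).sub_left (hYc.mul_left hRc)).eq
    · intro x z
      rw [LinearMap.sub_apply, LinearMap.sub_apply, map_sub, LinearMap.sub_apply, map_sub, Module.End.mul_apply,
        Module.End.mul_apply, Module.End.mul_apply, Module.End.mul_apply]
      have a1 := hRskew (Y.baseChange ℂ x) z
      have a2 := hYskewC x (R z)
      have a3 := hYskewC (R x) z
      have a4 := hRskew x (Y.baseChange ℂ z)
      linear_combination a1 - a2 - a3 + a4
    · intro i w hw
      obtain ⟨s, hs⟩ := hRall i
      rw [LinearMap.sub_apply, Module.End.mul_apply, Module.End.mul_apply, hs _ (hYW i w hw), hs w hw, map_smul, sub_self]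
  have hRE : R ∈ spanC (Subalgebra.toSubmodule H.endAlg) :=
    ThetaSubalgebra.mem_span_endAlg_of_forall_commute H 𝔤 hΘ hΘ𝔤 hRY
  -- `R ∈ 𝒜_ℂ`
  have h𝔇𝒜 : spanC 𝔡 ≤ spanC (Subalgebra.toSubmodule 𝒜) := spanC_mono fun X hX => h𝔡𝒜 X hX
  have hR𝒜 : R ∈ spanC (Subalgebra.toSubmodule 𝒜) := by
    rw [hRdef]
    exact Submodule.add_mem _ (CMTwist.spanC_mul_mem 𝒜 (CMTwist.spanC_mul_mem 𝒜 (h𝔇𝒜 hX𝔇) (h𝔇𝒜 hX𝔇)) (h𝔇𝒜 hX𝔇))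
      (Submodule.smul_mem _ _ (h𝔇𝒜 hX𝔇))
  -- `R ∈ (𝒜 ∩ E)_ℂ`
  have hRF : R ∈ spanC (Subalgebra.toSubmodule 𝒜 ⊓ Subalgebra.toSubmodule H.endAlg) := by
    rw [spanC_inf_eq]; exact ⟨hR𝒜, hRE⟩
  /- §D a rational non-scalar `t ∈ 𝒜 ∩ E` -/
  have hW0 : ∃ w ∈ W i₀, w ≠ 0 :=
    Submodule.exists_mem_ne_zero_of_ne_bot
      (fun h => by have h3 := hfin i₀; rw [h, finrank_bot] at h3; exact three_ne_zero h3.symm : W i₀ ≠ ⊥)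
  obtain ⟨t, htF, htns⟩ : ∃ t ∈ Subalgebra.toSubmodule 𝒜 ⊓ Subalgebra.toSubmodule H.endAlg, ∀ q : ℚ, t ≠ q • 1 := by
    by_contra hall'
    have hall : ∀ t ∈ Subalgebra.toSubmodule 𝒜 ⊓ Subalgebra.toSubmodule H.endAlg, ∃ q : ℚ, t = q • 1 := by
      intro t ht
      by_contra h'
      exact hall' ⟨t, ht, fun q hq => h' ⟨q, hq⟩⟩
    -- then every element of `(𝒜 ∩ E)_ℂ` is a scalar, in particular `R`
    have hscal : ∀ Y ∈ spanC (Subalgebra.toSubmodule 𝒜 ⊓ Subalgebra.toSubmodule H.endAlg), ∃ r : ℂ, Y = r • 1 := by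
      intro Y hY
      induction hY using Submodule.span_induction with
      | mem Y₀ hY₀ =>
        obtain ⟨t, ht, rfl⟩ := hY₀
        obtain ⟨q, hq⟩ := hall t ht
        refine ⟨q, ?_⟩
        show t.baseChange ℂ = (q : ℂ) • 1
        rw [hq, CMTwist.baseChange_rat_smul, LinearMap.baseChange_one]
      | zero => exact ⟨0, by rw [zero_smul]⟩
      | add Y₁ Y₂ _ _ h₁ h₂ =>
        obtain ⟨r₁, rfl⟩ := h₁; obtain ⟨r₂, rfl⟩ := h₂; exact ⟨r₁ + r₂, by rw [add_smul]⟩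
      | smul c' Y₁ _ h₁ => obtain ⟨r₁, rfl⟩ := h₁; exact ⟨c' * r₁, by rw [smul_smul]⟩
    obtain ⟨r, hr⟩ := hscal R hRF
    obtain ⟨w, hw, hw0⟩ := hW0
    -- `r = κ` (value on `W i₀`), and a skew scalar vanishes: `2 κ ψ_ℂ = 0`
    have hrκ : r = κ := by
      have h := hRi' w hw
      rw [hr, LinearMap.smul_apply, Module.End.one_apply] at h
      exact smul_left_injective ℂ hw0 h
    obtain ⟨cb, -, -, -, -, -, hdual, -⟩ := CMTheta.exists_adaptedDualBasis H hn heff ψ hφE hE μ hinj hdist hrank htop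
    have h1 : ψ.form.baseChange ℂ (cb ((i₀, 0), 0)) (cb ((i₀, 1), 0)) = 1 := by rw [hdual, if_pos ⟨rfl, rfl⟩]
    have h2 := hRskew (cb ((i₀, 0), 0)) (cb ((i₀, 1), 0))
    rw [hr, hrκ, LinearMap.smul_apply, LinearMap.smul_apply, Module.End.one_apply, Module.End.one_apply, map_smul,
      LinearMap.smul_apply, map_smul] at h2
    simp only [smul_eq_mul, h1, mul_one] at h2
    exact hκ (by linear_combination h2 / 2)
  obtain ⟨ht𝒜, htE⟩ := Submodule.mem_inf.1 htF
  rw [Subalgebra.mem_toSubmodule] at ht𝒜 htE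
  have ht'𝒜 : ψ.adjoint t ∈ 𝒜 := h𝒜adj t ht𝒜
  have ht'E : ψ.adjoint t ∈ H.endAlg := ψ.adjoint_mem_endAlg htE
  -- the scalars of `t`, `t†` on the two blocks
  obtain ⟨α, hα⟩ := CMTheta.exists_smul_of_mem_endAlg H hE htE (μ i₀)
  obtain ⟨β, hβ⟩ := CMTheta.exists_smul_of_mem_endAlg H hE ht'E (μ i₀)
  obtain ⟨αj, hαj⟩ := CMTheta.exists_smul_of_mem_endAlg H hE htE (μ j)
  obtain ⟨βj, hβj⟩ := CMTheta.exists_smul_of_mem_endAlg H hE ht'E (μ j)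
  refine ⟨t, htE, htns, α, β, hα, hβ, ?_⟩
  /- §E the twist relation on `𝒜` ties the scalars -/
  have h00 : ∀ (s s' : ℂ), (s • (1 : Matrix (Fin 3) (Fin 3) ℂ)) = s' • 1 → s = s' := fun s s' h => by
    have h' := congrFun (congrFun h 0) 0
    simpa using h'
  rcases htw with htw | ⟨-, htw⟩
  · -- INNER: `M i₀ Z = A⁻¹ (M j Z)^e A` for all `Z ∈ 𝒜`
    have hrel : ∀ Z (hZ : Z ∈ 𝒜), M i₀ Z hZ = A⁻¹ * (M j Z hZ).submatrix e.symm e.symm * A := by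
      intro Z hZ
      induction hZ using Algebra.adjoin_induction with
      | mem X hX => exact htw _ (baseChange_mem_spanC hX)
      | algebraMap r =>
        rw [hMalg, hMalg, CMTwist.submatrix_smul_apply, Matrix.submatrix_one_equiv, Matrix.mul_smul, Matrix.mul_one,
          Matrix.smul_mul, hAA]
      | add Z Z' hZ hZ' h h' =>
        rw [hMadd i₀ Z Z' hZ hZ', hMadd j Z Z' hZ hZ', h, h', CMTwist.submatrix_add_apply, Matrix.mul_add, Matrix.add_mul]
      | mul Z Z' hZ hZ' h h' =>
        rw [hMmul i₀ Z Z' hZ hZ', hMmul j Z Z' hZ hZ', h, h', ← Matrix.submatrix_mul_equiv _ _ e.symm e.symm e.symm]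
        simp only [Matrix.mul_assoc]
        rw [← Matrix.mul_assoc A A⁻¹, hAA', Matrix.one_mul]
    left
    have e1 := hrel t ht𝒜
    rw [hMscal i₀ t ht𝒜 α hα, hMscal j t ht𝒜 αj hαj, CMTwist.submatrix_smul_apply, Matrix.submatrix_one_equiv,
      Matrix.mul_smul, Matrix.mul_one, Matrix.smul_mul, hAA] at e1
    have e2 := hrel (ψ.adjoint t) ht'𝒜
    rw [hMscal i₀ _ ht'𝒜 β hβ, hMscal j _ ht'𝒜 βj hβj, CMTwist.submatrix_smul_apply, Matrix.submatrix_one_equiv,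
      Matrix.mul_smul, Matrix.mul_one, Matrix.smul_mul, hAA] at e2
    refine ⟨fun w hw => ?_, fun w hw => ?_⟩
    · rw [h00 _ _ e1]; exact hαj w hw
    · rw [h00 _ _ e2]; exact hβj w hw
  · -- TRANSPOSE: `M i₀ Z = A⁻¹ ((M j Z†)^e)ᵀ A` for all `Z ∈ 𝒜`
    have hrel : ∀ Z (hZ : Z ∈ 𝒜),
        M i₀ Z hZ = A⁻¹ * ((M j (ψ.adjoint Z) (h𝒜adj Z hZ)).submatrix e.symm e.symm)ᵀ * A := by
      intro Z hZ
      induction hZ using Algebra.adjoin_induction with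
      | mem X hX =>
        rw [hMcongr j (ψ.adjoint X) (-X) (h𝒜adj X (h𝔡𝒜 X hX)) (𝒜.neg_mem (h𝔡𝒜 X hX)) (hadjX X hX),
          hMneg j X (h𝔡𝒜 X hX), CMTwist.submatrix_neg_apply, Matrix.transpose_neg, Matrix.mul_neg, Matrix.neg_mul]
        exact htw _ (baseChange_mem_spanC hX)
      | algebraMap r =>
        have hadj1 : ψ.adjoint (algebraMap ℚ (Module.End ℚ V) r) = algebraMap ℚ (Module.End ℚ V) r := by
          rw [Algebra.algebraMap_eq_smul_one, ψ.adjoint_smul, ψ.adjoint_one]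
        rw [hMalg, hMcongr j _ _ (h𝒜adj _ (𝒜.algebraMap_mem r)) (𝒜.algebraMap_mem r) hadj1, hMalg,
          CMTwist.submatrix_smul_apply, Matrix.submatrix_one_equiv, Matrix.transpose_smul, Matrix.transpose_one,
          Matrix.mul_smul, Matrix.mul_one, Matrix.smul_mul, hAA]
      | add Z Z' hZ hZ' h h' =>
        rw [hMadd i₀ Z Z' hZ hZ', hMcongr j _ _ (h𝒜adj _ (𝒜.add_mem hZ hZ')) (𝒜.add_mem (h𝒜adj Z hZ) (h𝒜adj Z' hZ'))
          (ψ.adjoint_add Z Z'), hMadd j _ _ (h𝒜adj Z hZ) (h𝒜adj Z' hZ'), h, h', CMTwist.submatrix_add_apply,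
          Matrix.transpose_add, Matrix.mul_add, Matrix.add_mul]
      | mul Z Z' hZ hZ' h h' =>
        rw [hMmul i₀ Z Z' hZ hZ', hMcongr j _ _ (h𝒜adj _ (𝒜.mul_mem hZ hZ')) (𝒜.mul_mem (h𝒜adj Z' hZ') (h𝒜adj Z hZ))
          (ψ.adjoint_mul Z Z'), hMmul j _ _ (h𝒜adj Z' hZ') (h𝒜adj Z hZ), h, h',
          ← Matrix.submatrix_mul_equiv _ _ e.symm e.symm e.symm, Matrix.transpose_mul]
        simp only [Matrix.mul_assoc]
        rw [← Matrix.mul_assoc A A⁻¹, hAA', Matrix.one_mul]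
    right
    have e1 := hrel t ht𝒜
    rw [hMscal i₀ t ht𝒜 α hα, hMscal j _ (h𝒜adj t ht𝒜) βj hβj, CMTwist.submatrix_smul_apply, Matrix.submatrix_one_equiv,
      Matrix.transpose_smul, Matrix.transpose_one, Matrix.mul_smul, Matrix.mul_one, Matrix.smul_mul, hAA] at e1
    have e2 := hrel (ψ.adjoint t) ht'𝒜
    rw [hMscal i₀ _ ht'𝒜 β hβ, hMcongr j _ _ (h𝒜adj _ ht'𝒜) ht𝒜 (ψ.adjoint_adjoint t), hMscal j t ht𝒜 αj hαj,
      CMTwist.submatrix_smul_apply, Matrix.submatrix_one_equiv, Matrix.transpose_smul, Matrix.transpose_one,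
      Matrix.mul_smul, Matrix.mul_one, Matrix.smul_mul, hAA] at e2
    refine ⟨fun w hw => ?_, fun w hw => ?_⟩
    · rw [h00 _ _ e1]; exact hβj w hw
    · rw [h00 _ _ e2]; exact hαj w hw

end Hodge

end HodgeStructure

end Literature.AlgebraicGeometry.Motives
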